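/-
Copyright (c) 2026 the pub-hodgecm-mathlib formalisation cell (harness21).  Prover seat hodgecm-mathlib-K2E1-p15 (g3), Track B ∕ K2-LIT, h413 = `stmt-HodgeConjecture-24833`,
R90-TF section S8 «ContSpec-n½», #4′ road, DEFS OF RECORD of the LAYER 2 PRINT's block data `At`∕`Ln` (deal S8-R26 (H4) ∕ S8-R29 (3) 2026-09-04T22:09:09Z; DEF REGIME OF RECORD = R1,
ruling S8-R35 (1) 2026-09-04T22:15:59Z; DEF HEADS 22:17:36Z): the `(K′, ω)`-block `Sc` of a Hecke datum `χ`, its PURE-ATOM part `At = Sc ⊓ ker (snd ∘ U)` and its LINE part `Ln = Sc ⊓ Atᗮ`.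
-/
import Summits.HodgeConjecture.HodgeConjecture.Theorems.K2E1PseudoEisensteinFamilyDecompositionOpenCosetsU2    -- ★ HEAD″ p861008 (K2E1-p12): `blocks_open` — its `Blk` bytes are `resHBlock`; brings ★ `chiSectionSpace`, ★ `eisensteinSeriesU`, ★ `borelHeight`, ★ `quotFun`
import Mathlib.Analysis.InnerProductSpace.Projection.Submodule                                              -- Mathlib `Submodule.orthogonal` (`ᗮ`), `Submodule.inner_right_of_mem_orthogonal`
import HarnessLib

/-!
# S8 #4′ road — `R90S8ResHBlockDataU2Defs`: THE BLOCK DATA OF RECORD `Sc ∕ At ∕ Ln` of the LAYER 2 PRINT ★ `residual_le_topologicalClosure_iSup_charLines_of_letters` (regime R1)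

Track B ∕ K2-LIT, crux h413 = `stmt-HodgeConjecture-24833`, route of record `HCCMUnconditional`; cell `hodgecm-mathlib`, R90-TF programme, section S8 «ContSpec-n½», socket #4′
`sock_S8_resH_spannedByCharLines`.  DEFINITIONS FILE (`--kind definition --supports stmt-HodgeConjecture-24833`, ruling S8-R29 (3)): three `def`s + `Iff.rfl`∕`inf_le`-deep read-backs;
no `instance`, no `notation`, no named-fact hypothesis, no `sorry`; PRINT currency `quasiSplit L⁺ L c 2 = cmDatum L 2 ((antidiagonal 2).over L)` (`rfl`); GENERIC in the level datum
`(K' : Subgroup G(𝔸)) (ω : ↥K' →* ℂ)` and pointwise in the block `χ` (LETTER SHAPE RULE S8-R29 (2)).  CLOSES NO SOCKET; pays no letter; it FIXES THE BYTES the four letter payers key to: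
(E_blk) K2E1-p13 (g4) `Theorems/R90S8PseudoEisensteinBlocksDenseU2.lean`, (O) this seat `Theorems/R90S8ResHResiduesOrthogonalWavePacketsU2.lean`, (N_blk) R90-C133-p02 (g0)
`Theorems/R90S8ResHIsotypicVectorsAreResiduesU2.lean`, (L) K2E2-p12 (g8) `Theorems/R90S8ResHResiduesAreCharLinesU2.lean`; H7 (last link) instantiates the print's `At ∕ Ln` with them.

THE MATHEMATICS ([MoeglinWaldspurger1995, I.2.18, II.2.1, II.2.4, V.3.13, VI.2]; [Langlands1976, §7]; rank one [Rogawski1990, §13.9 p. 229]).  For the quasi-split `U(J₂) = U(1,1)_{L∕L⁺}`, a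
level datum `(K′, ω)` and a unitary Hecke character `χ` of `L` (a cuspidal datum of the Borel), the `L²` pseudo-Eisenstein series (wave packets) `[θ_{f,φ}] = [E(f(H)·φ)]`, `f ∈ C_c((0,∞))`
continuous, `φ ∈ V(χ, K′, ω)` continuous, span the `(K′,ω)`-BLOCK `Sc(K′,ω,χ)` := their CLOSED span in `L²(U(J₂)(L⁺)∖U(J₂)(𝔸_{L⁺}), μ)` (D1 `resHBlock` = the `Blk χ` bytes of ★ HEAD″
`blocks_open` = the left side of the print's letter (E_blk)).  The spectral decomposition of the block [MW VI.2] is `Sc = (⊕_{c ∈ S} Res_c) ⊕ 𝓛` — finitely many RESIDUE ATOMS at the real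
poles `c ∈ (½, 1]` of `E(φ, z)` and the unitary-axis CONTINUOUS part; the E1 estate reads it through a BLOCK-MODEL COORDINATE MAP `U : L² →ₗ[ℂ] A × Λ` (ATOMS × LINE; D5′ currency
★ `K2E1ResidualPartInAtomsCMTwo.hD5_of_letters`: `U b : L² →ₗ[ℂ] (A b × Lp (E b) 2 (m b))`, `U_b = U_SD ∘ P_{Sc_b}`, self-dual model ★ p860386 ∕ off-dual model with `A = 0`).  REGIME R1
(S8-R35 (1), K2E1-p13's CENSUS-Eblk §1): the PURE-ATOM part is D2 `resHAtom U := Sc ⊓ ker (snd ∘ U)` and the LINE part is DEFINED as its orthocomplement inside the block, D3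
`resHLine U := Sc ⊓ (resHAtom U)ᗮ` — so that (E_blk) `Sc ≤ closure (At ⊔ Ln)` is Hilbert-space algebra, (O) holds in-block by definition, (N_blk)'s interface «a block vector with zero line
coordinate is orthogonal to `Ln`» is `inner_eq_zero_of_mem_resHLine` below, and the ONE deep letter of the road — «pure-atom vectors are character classes» — is (L).  HONEST COST (booked
S8-R35 (1)): the identification «`resHLine` = closure of the unitary-axis wave packets `∫ h(t)·E(φ, ½+it) dt`» [MW VI.2] is NOT claimed anywhere and #4′ does not need it; `U` is a PARAMETER
(the payers' model letters say which `U`), so these defs are closed terms today.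
* D1 `resHBlock K' ω χ` (+ `resHBlock_def`, `subset_resHBlock`, `span_le_resHBlock`, `isClosed_resHBlock`).
* D2 `resHAtom U K' ω χ` (+ `mem_resHAtom_iff`, `resHAtom_le_resHBlock` = «at_le_sc», `resHAtom_le_ker`).
* D3 `resHLine U K' ω χ` (+ `mem_resHLine_iff`, `resHLine_le_resHBlock` = «ln_le_sc», `resHLine_le_orthogonal_resHAtom` = «ln_le_at_orthogonal», `isOrtho_resHAtom_resHLine` (in-block (O)),
  **`inner_eq_zero_of_mem_resHLine`** = the (N-iface) of R90-C133-p02's CENSUS-Nblk §2, instance-free: `v ∈ Ln → (∃ y ∈ Sc, x − y ∈ Scᗮ ∧ (U y).2 = 0) → ⟪v, x⟫ = 0`).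
CONSUMER SHAPE (H7): `At := fun ℓ b => resHAtom L μ (U ℓ b) (K' ℓ) (ω ℓ) ↑b`, `Ln := fun ℓ b => resHLine L μ (U ℓ b) (K' ℓ) (ω ℓ) ↑b`; `hEblk`'s left side is `resHBlock L μ (K' ℓ) (ω ℓ) ↑b` by `rfl`.
HONEST (S8-R38 (1)): H7 carries the block-model family `U ℓ b` TOGETHER WITH ITS MODEL LETTERS (D5′∕D4′ currency: self-dual Plancherel isometry, Gram letter, symbols) VISIBLY until the
level self-dual package (E1 TABLE «G9») lands; these definitions assert nothing about `U`.
HONEST LABEL: HC_CM is proved only modulo the 7 printed citations (2 remaining named inputs: hLiu418 = `stmt-HodgeConjecture-24832`, h413 = `stmt-HodgeConjecture-24833`) until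
rung 0 closes; REL ≠ ★ ≠ BUILT; definitions pay nothing; count-neutral.

## References
* [MoeglinWaldspurger1995] C. Mœglin, J.-L. Waldspurger, *Spectral Decomposition and Eisenstein Series* (1995), I.2.18, II.2.1, II.2.4, V.3.13, VI.2.
* [Langlands1976] R. P. Langlands, *On the Functional Equations Satisfied by Eisenstein Series*, LNM 544 (1976), §7.
* [Rogawski1990] J. D. Rogawski, *Automorphic Representations of Unitary Groups in Three Variables* (1990), §13.9 p. 229.
-/

set_option autoImplicit false
set_option linter.dupNamespace false  -- the mandated namespace `…HodgeConjecture.HodgeConjecture.R90.S8` (LEAD #1 L1) repeats the summit's segment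

noncomputable section

open MeasureTheory Measure Set Filter Topology NumberField
open Literature.NumberTheory.Automorphic Literature.NumberTheory.Automorphic.UnitaryGroup Literature.NumberTheory.GaloisRepresentations AdelicGroupData
open Summit.HodgeConjecture.HodgeConjecture.Cruxes.H413.K2E1BorelEisensteinU
open Summit.HodgeConjecture.HodgeConjecture.Cruxes.H413.K2E1ChiSectionSpaceU2Defs
open scoped ENNReal NNReal InnerProductSpace

namespace Summit.HodgeConjecture.HodgeConjecture.R90.S8

variable (L : Type) [Field L] [NumberField L] [IsCMField L]
  (μ : Measure (quasiSplit (↥(maximalRealSubfield L)) L (IsCMField.complexConj L) 2).automorphicQuotient)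

/-! ## D1 The `(K′, ω)`-block `Sc(K′, ω, χ)` — closed span of the `L²` pseudo-Eisenstein wave packets -/

/-- **D1 — THE `(K′, ω)`-BLOCK `Sc(K′, ω, χ)` OF THE DATUM `χ`**: the closed span in `L²(U(J₂)(L⁺)∖U(J₂)(𝔸_{L⁺}), μ)` of the classes of the pseudo-Eisenstein series `E(f(H)·φ)` with
`f ∈ C_c((0,∞))` continuous and `φ ∈ V(χ, K′, ω)` continuous — VERBATIM the `Blk χ` bytes of ★ HEAD″ `blocks_open` and the left side of the print's letter (E_blk) at `(K' ℓ, ω ℓ, ↑b) ↦ (K', ω, χ)`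
(K2E1-p13's `Sc K' ω b`). [cite: MoeglinWaldspurger1995, II.2.1, II.2.4] -/
def resHBlock (K' : Subgroup (quasiSplit (↥(maximalRealSubfield L)) L (IsCMField.complexConj L) 2).Adelic) (ω : ↥K' →* ℂ) (χ : HeckeCharacter L) :
    Submodule ℂ ((quasiSplit (↥(maximalRealSubfield L)) L (IsCMField.complexConj L) 2).L2 μ) :=
  (Submodule.span ℂ {v : (quasiSplit (↥(maximalRealSubfield L)) L (IsCMField.complexConj L) 2).L2 μ |
      ∃ (f : ℝ → ℂ) (_ : Continuous f) (_ : HasCompactSupport f) (_ : tsupport f ⊆ Ioi 0)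
        (φ : (quasiSplit (↥(maximalRealSubfield L)) L (IsCMField.complexConj L) 2).Adelic → ℂ) (_ : φ ∈ chiSectionSpace χ K' (ω : ↥K' → ℂ)) (_ : Continuous φ)
        (hv : MemLp ((quasiSplit (↥(maximalRealSubfield L)) L (IsCMField.complexConj L) 2).quotFun (eisensteinSeriesU (fun g => f (borelHeight g) * φ g))) 2 μ), v = hv.toLp _}).topologicalClosure

/-- Read-back: `resHBlock` unfolds to the print's bytes (`rfl`). [cite: MoeglinWaldspurger1995, II.2.4] -/
theorem resHBlock_def (K' : Subgroup (quasiSplit (↥(maximalRealSubfield L)) L (IsCMField.complexConj L) 2).Adelic) (ω : ↥K' →* ℂ) (χ : HeckeCharacter L) :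
    resHBlock L μ K' ω χ =
      (Submodule.span ℂ {v : (quasiSplit (↥(maximalRealSubfield L)) L (IsCMField.complexConj L) 2).L2 μ |
          ∃ (f : ℝ → ℂ) (_ : Continuous f) (_ : HasCompactSupport f) (_ : tsupport f ⊆ Ioi 0)
            (φ : (quasiSplit (↥(maximalRealSubfield L)) L (IsCMField.complexConj L) 2).Adelic → ℂ) (_ : φ ∈ chiSectionSpace χ K' (ω : ↥K' → ℂ)) (_ : Continuous φ)
            (hv : MemLp ((quasiSplit (↥(maximalRealSubfield L)) L (IsCMField.complexConj L) 2).quotFun (eisensteinSeriesU (fun g => f (borelHeight g) * φ g))) 2 μ), v = hv.toLp _}).topologicalClosure :=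
  rfl

/-- Read-back: the generating wave packets lie in the block. [cite: MoeglinWaldspurger1995, II.2.1] -/
theorem subset_resHBlock (K' : Subgroup (quasiSplit (↥(maximalRealSubfield L)) L (IsCMField.complexConj L) 2).Adelic) (ω : ↥K' →* ℂ) (χ : HeckeCharacter L) :
    {v : (quasiSplit (↥(maximalRealSubfield L)) L (IsCMField.complexConj L) 2).L2 μ |
        ∃ (f : ℝ → ℂ) (_ : Continuous f) (_ : HasCompactSupport f) (_ : tsupport f ⊆ Ioi 0)
          (φ : (quasiSplit (↥(maximalRealSubfield L)) L (IsCMField.complexConj L) 2).Adelic → ℂ) (_ : φ ∈ chiSectionSpace χ K' (ω : ↥K' → ℂ)) (_ : Continuous φ)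
          (hv : MemLp ((quasiSplit (↥(maximalRealSubfield L)) L (IsCMField.complexConj L) 2).quotFun (eisensteinSeriesU (fun g => f (borelHeight g) * φ g))) 2 μ), v = hv.toLp _} ⊆
      (resHBlock L μ K' ω χ : Set ((quasiSplit (↥(maximalRealSubfield L)) L (IsCMField.complexConj L) 2).L2 μ)) :=
  Submodule.subset_span.trans (Submodule.le_topologicalClosure _)

/-- Read-back: the algebraic span of the wave packets lies in the block (the shape (E_blk)'s payer starts from). [cite: MoeglinWaldspurger1995, II.2.1] -/
theorem span_le_resHBlock (K' : Subgroup (quasiSplit (↥(maximalRealSubfield L)) L (IsCMField.complexConj L) 2).Adelic) (ω : ↥K' →* ℂ) (χ : HeckeCharacter L) :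
    Submodule.span ℂ {v : (quasiSplit (↥(maximalRealSubfield L)) L (IsCMField.complexConj L) 2).L2 μ |
        ∃ (f : ℝ → ℂ) (_ : Continuous f) (_ : HasCompactSupport f) (_ : tsupport f ⊆ Ioi 0)
          (φ : (quasiSplit (↥(maximalRealSubfield L)) L (IsCMField.complexConj L) 2).Adelic → ℂ) (_ : φ ∈ chiSectionSpace χ K' (ω : ↥K' → ℂ)) (_ : Continuous φ)
          (hv : MemLp ((quasiSplit (↥(maximalRealSubfield L)) L (IsCMField.complexConj L) 2).quotFun (eisensteinSeriesU (fun g => f (borelHeight g) * φ g))) 2 μ), v = hv.toLp _} ≤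
      resHBlock L μ K' ω χ :=
  Submodule.le_topologicalClosure _

/-- Read-back: the block is closed (hence complete — the orthogonal projection onto it exists; K2E1-p13's `K`). [cite: MoeglinWaldspurger1995, II.2.4] -/
theorem isClosed_resHBlock (K' : Subgroup (quasiSplit (↥(maximalRealSubfield L)) L (IsCMField.complexConj L) 2).Adelic) (ω : ↥K' →* ℂ) (χ : HeckeCharacter L) :
    IsClosed (resHBlock L μ K' ω χ : Set ((quasiSplit (↥(maximalRealSubfield L)) L (IsCMField.complexConj L) 2).L2 μ)) :=
  Submodule.isClosed_topologicalClosure _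

/-! ## D2 The pure-atom part `At = Sc ⊓ ker (snd ∘ U)` and D3 the line part `Ln = Sc ⊓ Atᗮ` (regime R1) -/

variable {A Λ : Type*} [AddCommGroup A] [Module ℂ A] [AddCommGroup Λ] [Module ℂ Λ]

/-- **D2 — THE PURE-ATOM PART `At(U; K′, ω, χ) := Sc ⊓ ker (snd ∘ U)`**: the block vectors whose LINE coordinate vanishes in a block-model coordinate map `U : L² →ₗ[ℂ] A × Λ` (atoms × line;
D5′ currency `U_b = U_SD ∘ P_{Sc_b}`; for an off-dual `χ` the model has `A = 0` and `At = ⊥`).  In the mathematics: the span of the residues `Res_{z=c} E(φ, z)`, `c ∈ (½, 1]` a pole, `φ ∈ V(χ, K′, ω)`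
— for `U(1,1)` the character lines `ℂ·[ψ∘det]` of the block (letter (L)). [cite: MoeglinWaldspurger1995, V.3.13, VI.2] [cite: Rogawski1990, §13.9 p. 229] -/
def resHAtom (U : (quasiSplit (↥(maximalRealSubfield L)) L (IsCMField.complexConj L) 2).L2 μ →ₗ[ℂ] A × Λ)
    (K' : Subgroup (quasiSplit (↥(maximalRealSubfield L)) L (IsCMField.complexConj L) 2).Adelic) (ω : ↥K' →* ℂ) (χ : HeckeCharacter L) :
    Submodule ℂ ((quasiSplit (↥(maximalRealSubfield L)) L (IsCMField.complexConj L) 2).L2 μ) :=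
  resHBlock L μ K' ω χ ⊓ LinearMap.ker ((LinearMap.snd ℂ A Λ).comp U)

/-- **D3 — THE LINE PART `Ln(U; K′, ω, χ) := Sc ⊓ At(U)ᗮ`** (regime R1: the orthocomplement of the pure atoms INSIDE the block; in the mathematics the closure of the unitary-axis wave packets
`∫ h(t)·E(φ, ½ + it) dt`, an identification #4′ does not use). [cite: MoeglinWaldspurger1995, VI.2] [cite: Langlands1976, §7] -/
def resHLine (U : (quasiSplit (↥(maximalRealSubfield L)) L (IsCMField.complexConj L) 2).L2 μ →ₗ[ℂ] A × Λ)
    (K' : Subgroup (quasiSplit (↥(maximalRealSubfield L)) L (IsCMField.complexConj L) 2).Adelic) (ω : ↥K' →* ℂ) (χ : HeckeCharacter L) :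
    Submodule ℂ ((quasiSplit (↥(maximalRealSubfield L)) L (IsCMField.complexConj L) 2).L2 μ) :=
  resHBlock L μ K' ω χ ⊓ (resHAtom L μ U K' ω χ)ᗮ

variable (U : (quasiSplit (↥(maximalRealSubfield L)) L (IsCMField.complexConj L) 2).L2 μ →ₗ[ℂ] A × Λ)
  (K' : Subgroup (quasiSplit (↥(maximalRealSubfield L)) L (IsCMField.complexConj L) 2).Adelic) (ω : ↥K' →* ℂ) (χ : HeckeCharacter L)

/-- Read-back: `v ∈ At ↔ v ∈ Sc ∧ (U v).2 = 0`. [cite: MoeglinWaldspurger1995, VI.2] -/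
theorem mem_resHAtom_iff (v : (quasiSplit (↥(maximalRealSubfield L)) L (IsCMField.complexConj L) 2).L2 μ) :
    v ∈ resHAtom L μ U K' ω χ ↔ v ∈ resHBlock L μ K' ω χ ∧ (U v).2 = 0 :=
  Iff.rfl

/-- Read-back «at_le_sc»: `At ≤ Sc`. [cite: MoeglinWaldspurger1995, VI.2] -/
theorem resHAtom_le_resHBlock : resHAtom L μ U K' ω χ ≤ resHBlock L μ K' ω χ :=
  inf_le_left

/-- Read-back: `At ≤ ker (snd ∘ U)` — pure atoms have zero line coordinate. [cite: MoeglinWaldspurger1995, VI.2] -/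
theorem resHAtom_le_ker : resHAtom L μ U K' ω χ ≤ LinearMap.ker ((LinearMap.snd ℂ A Λ).comp U) :=
  inf_le_right

/-- Read-back: `v ∈ Ln ↔ v ∈ Sc ∧ v ∈ Atᗮ`. [cite: MoeglinWaldspurger1995, VI.2] -/
theorem mem_resHLine_iff (v : (quasiSplit (↥(maximalRealSubfield L)) L (IsCMField.complexConj L) 2).L2 μ) :
    v ∈ resHLine L μ U K' ω χ ↔ v ∈ resHBlock L μ K' ω χ ∧ v ∈ (resHAtom L μ U K' ω χ)ᗮ :=
  Iff.rfl

/-- Read-back «ln_le_sc»: `Ln ≤ Sc`. [cite: MoeglinWaldspurger1995, VI.2] -/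
theorem resHLine_le_resHBlock : resHLine L μ U K' ω χ ≤ resHBlock L μ K' ω χ :=
  inf_le_left

/-- Read-back «ln_le_at_orthogonal»: `Ln ≤ Atᗮ`. [cite: MoeglinWaldspurger1995, VI.2] -/
theorem resHLine_le_orthogonal_resHAtom : resHLine L μ U K' ω χ ≤ (resHAtom L μ U K' ω χ)ᗮ :=
  inf_le_right

/-- Read-back (in-block half of letter (O)): `At ⟂ Ln`. [cite: MoeglinWaldspurger1995, VI.2] -/
theorem isOrtho_resHAtom_resHLine : resHAtom L μ U K' ω χ ⟂ resHLine L μ U K' ω χ :=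
  (Submodule.isOrtho_orthogonal_right _).mono_right (resHLine_le_orthogonal_resHAtom L μ U K' ω χ)

/-- **Read-back (N-iface) — «a vector whose block component has zero line coordinate is orthogonal to `Ln`»** (R90-C133-p02's CENSUS-Nblk §2, instance-free spelling): if `v ∈ Ln` and `x` splits
as `x = y + (x − y)` with `y ∈ Sc`, `x − y ⟂ Sc` and `(U y).2 = 0` (the (N_blk) payer takes `y := P_{Sc} x`; `(U y).2 = 0` is ★ D5′'s conclusion, `U_b = U_SD ∘ P_{Sc}`), then `⟪v, x⟫ = 0`:
`y ∈ At`, `v ∈ Atᗮ ⊓ Sc`, so `⟪v, x⟫ = ⟪v, y⟫ + ⟪v, x − y⟫ = 0 + 0`. [cite: MoeglinWaldspurger1995, V.3.13, VI.2] -/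
theorem inner_eq_zero_of_mem_resHLine {v : (quasiSplit (↥(maximalRealSubfield L)) L (IsCMField.complexConj L) 2).L2 μ} (hv : v ∈ resHLine L μ U K' ω χ)
    (x : (quasiSplit (↥(maximalRealSubfield L)) L (IsCMField.complexConj L) 2).L2 μ)
    (hx : ∃ y ∈ resHBlock L μ K' ω χ, x - y ∈ (resHBlock L μ K' ω χ)ᗮ ∧ (U y).2 = 0) :
    ⟪v, x⟫_ℂ = 0 := by
  obtain ⟨y, hy, hxy, hUy⟩ := hx
  have h1 : ⟪v, y⟫_ℂ = 0 := by
    rw [inner_eq_zero_symm]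
    exact Submodule.inner_right_of_mem_orthogonal ((mem_resHAtom_iff L μ U K' ω χ y).2 ⟨hy, hUy⟩) hv.2
  have h2 : ⟪v, x - y⟫_ℂ = 0 := Submodule.inner_right_of_mem_orthogonal hv.1 hxy
  calc ⟪v, x⟫_ℂ = ⟪v, y + (x - y)⟫_ℂ := by rw [add_sub_cancel]
    _ = 0 := by rw [inner_add_right, h1, h2, add_zero]

end Summit.HodgeConjecture.HodgeConjecture.R90.S8

end
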